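import Mathlib
import HarnessLib
import HarnessLib.Audit
import Summits.SmoothPoincare4.Statement
import Literature.Topology.FourManifolds.HomotopySpheres
import Literature.Topology.FourManifolds.SmoothOrientation
import Literature.Geometry.Symplectic.SteinDomain
import Literature.Geometry.Symplectic.StandardEnd
import Literature.Geometry.Symplectic.GromovR4RelEnd
import Literature.Geometry.Symplectic.GromovMcDuffTwistedSphereProofs
import Literature.Topology.FourManifolds.HomotopyS4CompactProofs
import Literature.Topology.FourManifolds.HomotopyS4OrientableProofs
import Summits.SmoothPoincare4.SmoothPoincare4.Theorems.SullivanDualSpc4ReductionHomotopySphere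
import Literature.Geometry.Symplectic.AlmostComplexStructure
import Literature.Topology.FourManifolds.ComplexProjectiveSpace
import Literature.Geometry.Symplectic.JHolomorphicMap
import Literature.Geometry.Symplectic.PlusOneSpherePairProofs
import Literature.Topology.FourManifolds.ComplexProjectiveSpaceCohomology

/-!
Route: SymplecticCap

DORMANT since 2026-09-04T19:06:12Z (reconciler: no traction for 5 d (last activity statement-checked at 2026-08-30T18:05:45Z); parked, not closed — `ledger route dormant route-SmoothPoincare4-SymplecticCap --off` to reactivate) — unstaffed, not closed; items shared with open routes are served there. `ledger route dormant <id> --off` reactivates.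

# Route SymplecticCap — recognise the ball symplectically — a form on Σ ∖ p standard at the
puncture, plus Gromov's relative recognition of ℝ⁴ as an explicit crux

It suffices to show X: for every homotopy 4-sphere Σ and every point p ∈ Σ, the punctured manifold Σ
∖ {p} carries a
symplectic form (a smooth, closed, pointwise nondegenerate 2-form) which, on a punctured chart-ball
at p, equals the pullback of the
standard form ω₀ = dx₀∧dx₁ + dx₂∧dx₃ along the inverted recentred chart ι ∘ (e − e p), ι(z) =
z/‖z‖², e = extChartAt (𝓡 4) p —
i.e. (Σ ∖ p, ω) is symplectically STANDARD AT INFINITY, the end being parametrised by the chart at p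
(item SympcapThesisV2,
stmt-SmoothPoincare4-0518; packaged predicate
`Literature.Geometry.Symplectic.IsSymplecticStandardNearPoint`). Under Gromov's recognition of
(ℝ⁴, ω₀) relative at infinity — the explicit crux GromovRecognitionRelEnd of this route (promoted
2026-08-15 from the Literature named
fact `gromov_recognitionR4_relEnd`, judged XL-apex) — X gives Σ ∖ p ≅ ℝ⁴ by a diffeomorphism equal
to the inverted chart near p, hence
Σ = D⁴ ∪_id D⁴ ≅ S⁴. Realises no idea card (survey route of 2026-08-13).
Lean: `∀ (S : Literature.Topology.FourManifolds.HomotopySphere 4) (p : S.carrier), ∃ (ε : ℝ) (sf :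
Literature.Geometry.Kaehler.MForm (𝓡 4) (Literature.Geometry.Symplectic.punctured p) ℝ 2),
Literature.Geometry.Symplectic.IsSymplecticStandardNearPoint p ε sf`

## Assembly
Pure logic over in-tree theorems — the deciding theorem `closes (hG : GromovRecognitionRelEnd) (hX :
SympcapThesisV2) : SmoothPoincare4`
is PROVED in the route file (8 lines; native audit ok, axioms propext/Classical.choice/Quot.sound):
given a smooth M ≃ₕ S⁴, M is compact
(`Literature.Topology.FourManifolds.compactSpace_of_homotopyEquiv_sphere_four_holds`) and orientable
(`…isOrientable_of_homotopyEquiv_sphere_four_holds`), so it packages as S : HomotopySphere 4; pick p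
:= e⁻¹(pt); hX S p gives (ε, sf); then
`Literature.Geometry.Symplectic.nonempty_diffeomorph_sphere_of_recognitionR4_relEnd hG S p ε sf`
(chart form of the recognition theorem —
Σ ∖ p is connected with π₂ = 0 by general position — then Σ = D⁴ ∪_id D⁴ ≅ S⁴ by uniqueness of
gluing two discs, Hirsch 8.2.1; no Cerf,
no Palais, no Freedman) is the required `Nonempty (M ≃ₘ S⁴)`.
The ONE intended assembly ITEM is `Assembly` (stmt-SmoothPoincare4-0428), re-signed 2026-08-16
(route-repair g3, `workitem set-signature`)
to the deciding chain in thesis-first order, `SympcapThesisV2 → GromovRecognitionRelEnd →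
SmoothPoincare4` — provable now by
`fun hX hG => closes hG hX` (compiled against the live route file in the planner sketch
folder/sk/Sketch.lean); its v1 docstring (strong
filling Δ ≅ B⁴ + Cerf) describes the 2026-08-13 proof idea of X → SPC4 and is superseded by this
paragraph. LEGACY assembly-kind items
`Assembly2` (stmt-SmoothPoincare4-0444) and `Assembly3` (stmt-SmoothPoincare4-0519) are ONE
proposition (verbatim equal), superseded, and
PROVED in tree verbatim as `Literature.SPC4.sympcap_assembly`
(Summits/SmoothPoincare4/SmoothPoincare4/Theorems/SymplecticCapAssembly.lean) —
each closes by `exact Literature.SPC4.sympcap_assembly`. OPERATOR REQUEST (verified again 2026-08-16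
by the g3 repair seat: the gate answers
'the assembly item cannot be dropped' to `route edit --drop 0519|0444`, 'cannot be retriaged (item
is assembly)' to `--retriage`, counts HELD
items, and bounces every other structural edit (--drop/ --restate of any item) on the post-check
'route.multi-assembly: 3 assembly items;
route.items-cap 16 > 15'): please `ledger workitem close stmt-SmoothPoincare4-0519 --as proved --by
Literature.SPC4.sympcap_assembly`, the
same for stmt-SmoothPoincare4-0444, or drop both; then the planner-side drops of the held duplicates
SympThesis (0427, δ-equal to the target)
and SympSteinSplitS3 (0429, verbatim = SteinSplitV2) and of the redundant DirectClosure (9123, =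
closes) / Spc4ReductionHomotopySphereV2 (0441)
go through in one `route edit --drop … ` and the route is at 1 assembly, 4 cruxes, 11 items.

Rationale: WHY THIS LINE. Every other open route on this summit manipulates handles or metrics; this one
imports the one rigidity engine in dimension 4 that
recognises ℝ⁴ (equivalently the ball) outright — Gromov's J-holomorphic-curve recognition of (ℝ⁴,
ω₀) among connected symplectic
4-manifolds with π₂ = 0 that are standard at infinity [Gromov1985 §0.3.C and 2.4.A₂′;
McDuffSalamon2017 Rem. 4.5.2 (viii), read on the
held copy PDF p. 193; exposition McDuffSalamon2012 §9.4] — and converts SPC4 into an EXISTENCE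
problem for a closed nondegenerate 2-form
with prescribed germ at one point of a homotopy sphere: an h-principle-type question on the
contractible open manifold Σ ∖ p, where the
formal (almost-symplectic) obstruction vanishes [Gromov1986, EliashbergMishachev2002] and only the
behaviour at the end is constrained.
Route-choice repair (this revision): the recognition theorem was consumed as the Literature named
fact `gromov_recognitionR4_relEnd`
(audited faithful, but its discharge is Fredholm theory + Gromov compactness + positivity of
intersections + McDuff's CP² recognition +
Moser, none of it in Mathlib, too large for one seat and unsplittable as a non-crux fact); it is
PROMOTED to the ranked crux
GromovRecognitionRelEnd (the audited statement transcribed VERBATIM — `GromovRecognitionRelEnd ↔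
gromov_recognitionR4_relEnd := Iff.rfl`,
checked — so that no item body names the cite-only constant and the staffable census counts the
theorem as this route's own crux:
rev 9 'staffable: YES — 0 unproved deps') and the deciding theorem is rewired to
closes : GromovRecognitionRelEnd → SympcapThesisV2 → SmoothPoincare4, proved from in-tree results
only (chart form of the fact,
double-of-discs glue, uniqueness of gluing two discs, compactness/orientability of homotopy
4-spheres). Imported from symplectic
topology: holomorphic curves (crux GromovRecognitionRelEnd) and Stein/Weinstein fillings
[Eliashberg1990, Gompf1998, AkbulutMatveyev1998]
(crux SteinSplitV2). Catalogue: geometric lift (symplectic structure as auxiliary object). Not used: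
spectral, probabilistic.

RANKED CRUXES. #0 SympcapThesisV2 (target) — X — every punctured homotopy 4-sphere Σ ∖ p carries a
symplectic form standard at infinity in the chart at p (existing item stmt-SmoothPoincare4-0518,
checked). [difficulty: open-problem] (why it might fail: X ⟺ SPC4 given Gromov's recognition
theorem, so it is false iff an exotic 4-sphere exists; and no construction of a symplectic form with
prescribed END germ is known — the h-principle (Gromov1986) realises every formal class on Σ∖p but
pushes the obstruction to infinity.) [Gromov1985, McDuffSalamon2017, McDuff1990, Gromov1986,
EliashbergMishachev2002]
#2 SympEndStandard (crux) — chart-free form of X — Σ ∖ p carries a symplectic form which outside a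
compact K is the pullback of ω₀ along SOME proper end parametrisation ψ onto {R < ‖z‖} (binders 8–16
of the recognition theorem with M := Σ ∖ p; existing item stmt-SmoothPoincare4-8775). With
GromovRecognitionRelEnd it gives only Σ ∖ p ≅ ℝ⁴, hence needs SympPuncturedStandard to close; X ⇒ it
(support ThesisGivesEndStandard). [difficulty: open-problem] (why it might fail: under the fact it
asserts Σ∖p ≅ ℝ⁴ for every homotopy 4-sphere — open (GompfStipsicz1999 §9.4): an exotic ℝ⁴ with a
smooth product end S³×[0,∞) would puncture an exotic Σ and refute it; and no method makes a
symplectic form standard on a prescribed END of a contractible 4-manifold.) [McDuffSalamon2017,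
Gromov1985, GompfStipsicz1999, Gompf1998, DeMichelisFreedman1992, Mazur1959]
#2 SteinSplitV2 (crux) — every homotopy 4-sphere splits along a smoothly embedded S³ into two
compact Stein domains (an Akbulut–Matveyev bisection whose seam is S³; existing item
stmt-SmoothPoincare4-0508, checked). Alternative spine: with Eliashberg's filling theorem both
pieces are B⁴ and Σ is a twisted sphere. [difficulty: open-problem] (why it might fail: ⟺ SPC4 given
Eliashberg's filling theorem; constructively it needs a Stein structure on an arbitrary homotopy
4-ball, and the only known source (Eliashberg–Gompf Legendrian 2-handles with framing tb−1)
presupposes a 3-handle-free decomposition of Σ (open, route NoOneHandles) AND realisable framings.)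
[AkbulutMatveyev1998, Eliashberg1990, Eliashberg1992, Gompf1998, Eliashberg1990Stein,
CieliebakEliashberg2012]
#3 GromovRecognitionRelEnd (crux) — NEW (promoted fact, verbatim transcription): Gromov's
recognition of (ℝ⁴, ω₀) relative at infinity — a connected symplectic 4-manifold (M, ω) with π₂(M) =
0 which outside a compact set is symplectomorphic (ψ) to a neighbourhood of infinity of (ℝ⁴, ω₀)
(ends clause: every sub-end co-compact) is symplectomorphic to (ℝ⁴, ω₀) by a Φ equal to ψ outside a
compact set [McDuffSalamon2017 Rem. 4.5.2 (viii) verbatim; Gromov1985 §0.3.C, 2.4.A₂′]. The Lean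
item is the audited Literature statement
`Literature.Geometry.Symplectic.gromov_recognitionR4_relEnd` transcribed verbatim (`↔` by `Iff.rfl`,
folder/sk/Sketch2.lean; refuter audit of the fact: faithful; non-vacuity
`gromov_recognitionR4_relEnd.apply_stdModel` / `stdModel_hypotheses` in tree apply to the item by
`exact`); a proof of either closes the other by `exact h`. Load-bearing in closes (hypothesis hG).
[difficulty: XL] (why it might fail: True in print, but the RELATIVE clause (Φ = ψ off a compact
set) is printed only as MS2017 Rem 4.5.2(viii) without proof (detailed exposition MS2012 §9.4 not
held, acq-00635): J-curve coordinates need an extra extension/Symp_c(ℝ⁴,ω₀) step; and Lean has no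
J-holomorphic-curve theory at all (XL).) [McDuffSalamon2017, Gromov1985, McDuffSalamon2012,
McDuff1990, book:mcduff2017-introduction-symplectic-topology,
book:wendlnd-holomorphic-curves-low-dimensions]
#4 SympPuncturedStandard (crux) — punctured-standard ⇒ standard: if Σ ∖ p ≅ ℝ⁴ then Σ ≅ S⁴ (existing
item stmt-SmoothPoincare4-0431, checked); load-bearing only for the chart-free spine through
SympEndStandard. [deps: SympEndStandard] [difficulty: open-problem] (why it might fail: equivalent
to the smooth Schoenflies conjecture ('wide open', Kirby1989 p. 14): a non-standard Schoenflies ball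
A gives Σ = A ∪ D⁴ with Σ∖p ≅ int A ∪ collar ≅ ℝ⁴ yet Σ ≇ S⁴; the analogue one pattern up is false
(Σ⁷∖pt ≅ ℝ⁷ for Milnor's exotic Σ⁷), so no soft argument exists.) [Mazur1959, Kirby1989, Kirby1997,
Palais1960, Cerf1968, GompfStipsicz1999]
#9 Assembly (assembly, stmt-SmoothPoincare4-0428) — the single intended assembly item, re-signed
2026-08-16 to the deciding chain in thesis-first order `SympcapThesisV2 → GromovRecognitionRelEnd →
SmoothPoincare4`; provable now by `fun hX hG => closes hG hX`. [difficulty: provable-now]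
[Gromov1985, McDuffSalamon2017]
#9 SympLegendrianHandlebody (support, stmt-SmoothPoincare4-0430) — SIGNED 2026-08-16 with its
typable core: every homotopy 4-ball (compact contractible smooth 4-manifold W with ∂W ≃ₜ S³) is a
Stein domain (`Literature.Geometry.Symplectic.IsSteinDomain W`). By Gompf1998 Thm 1.3 (Eliashberg's
criterion in handle form, converse included: a compact 4-manifold is Stein iff it has a
3- /4-handle-free decomposition whose 2-handles are Legendrian with framing tb − 1) this is
EQUIVALENT to the informal Legendrian-handlebody wording it replaces, whose realisation predicate
Literature still lacks (LegendrianKirbyDiagram.lean landed 2026-08-14 as the combinatorial layer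
only). It is the W₂ := chart-ball strengthening of crux SteinSplitV2, hence its foreseen child, and
like it ⟺ SPC4 modulo printed theorems (⇐ SPC4 + Palais: W ≅ B⁴ ⊂ ℂ², φ = |z|²; ⇒ Eliashberg1990 Thm
5.1 + Cerf). Unranked: does not drive staffing, not a hypothesis of closes. [deps: SteinSplitV2]
[difficulty: open-problem] (why it might fail: needs a 3-handle-free decomposition of EVERY homotopy
4-ball (open; route NoOneHandles) and Legendrian realisability of the framings (the tb − 1 bound
fails for many framed links).) [Gompf1998, Eliashberg1990Stein, Eliashberg1990, AkbulutMatveyev1998]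
#9 SympcapGlueChartStandardEnd (support) — glue, PROVED in Literature
(`Literature.Geometry.Symplectic.sympcap_glue_chartStandardEnd`,
GromovMcDuffTwistedSphereProofs.lean, verbatim up to δ): a diffeomorphism Σ ∖ p ≃ₘ ℝ⁴ equal to the
inverted chart near p extends to Σ ≃ₘ S⁴ (existing item stmt-SmoothPoincare4-0443; close with a
one-line `exact`). [difficulty: provable-now] [Hirsch1976, Palais1960]
#9 Spc4ReductionHomotopySphere (support) — shared bookkeeping reduction (6 routes): (∀ S :
HomotopySphere 4, S ≅ S⁴) → SmoothPoincare4; provable now from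
`Literature.SPC4.smoothPoincare4_of_forall_homotopySphere` +
`compactSpace_of_homotopyEquiv_sphere_four_holds` +
`isOrientable_of_homotopyEquiv_sphere_four_holds` (existing item stmt-SmoothPoincare4-0374).
[difficulty: provable-now] [HatcherAT2002, LeeSmoothManifolds2013, KervaireMilnor1963]
#9 ThesisGivesEndStandard (support) — X → SympEndStandard — the chart end is an end: ψ = ι ∘ (e − e
p) on a punctured ε-chart-ball U with closed image ball inside the chart target, K = Uᶜ, R = ε⁻¹, χ
= e⁻¹(e p + ι ·); the nine clauses are the bookkeeping inside the proof of
`gromov_recognitionR4_relEnd.chartForm` (existing item stmt-SmoothPoincare4-9114). [difficulty: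
provable-now] [McDuffSalamon2017]
#9 SympcapEndStandardClosure (support) — chain B glue: GromovRecognitionRelEnd → SympEndStandard →
SympPuncturedStandard → SmoothPoincare4 (stmt-SmoothPoincare4-11345; 12 tactic lines compiled
sorry-free in the 2026-08-15 planner sketch, attached as evidence). [difficulty: provable-now]
[McDuffSalamon2017, Gromov1985]
LEGACY / REDUNDANT (kept only because the gate refuses planner drops while two legacy assembly-kind
items exist — see the OPERATOR REQUEST in the thesis' Assembly paragraph): Assembly2 (0444) ≡
Assembly3 (0519), superseded assemblies proved in tree as `Literature.SPC4.sympcap_assembly` (close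
by `exact`); DirectClosure (9123) = the deciding theorem in fact-first order (`closes` itself;
redundant with Assembly); SympThesis (0427, δ-equal to the target 0518) and SympSteinSplitS3 (0429,
verbatim = SteinSplitV2) — both HELD 2026-08-16 so no seat is spent on a duplicate;
Spc4ReductionHomotopySphereV2 (0441, the reduction with the two packaging facts as hypotheses —
redundant with 0374 now that both facts are proved; shared with other routes, not held).

TWO-LAYER PLAN. GromovRecognitionRelEnd ⇐ D1 → D2 → GromovRecognitionRelEnd (k = 2, to be filed with
`route edit --split` on the crux's final cycle only):
D1 = the DIFFEOMORPHISM-rel-end version (same binders; conclusion ∃ Φ : M ≃ₘ ℝ⁴ with Φ = ψ off a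
compact set, no `sf = Φ*ω₀`) — this
child alone carries the route (the in-tree adapter `gromov_recognitionR4_relEnd.chartForm` discards
the symplectic conjunct: `obtain
⟨Φ, -, K', hK', hΦ⟩`, so a prover can re-prove it from D1 with `--supports`); D2 = uniqueness rel
end of symplectic forms on ℝ⁴ standard at
infinity (ω = ω₀ off a compact set ⇒ (ℝ⁴, ω) ≅ (ℝ⁴, ω₀) by a symplectomorphism that is the identity
off a compact set) [Gromov1985
2.4.A₂′: 'the standard structure on ℝ⁴ is uniquely determined by its behaviour at infinity']; glue
D1 → D2 → parent is Moser-free logic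
(transport sf by Φ, apply D2, compose). Inside D1 the foreseen proof (recorded for the tenure
planner, not a third layer): truncate the
end at radius R' and compactify by the line at infinity ((B⁴(R'), ω₀) ≅ (CP² ∖ CP¹, c·ω_FS)) to a
closed symplectic X ⊃ L, L·L = +1, whose
complement X ∖ L ⊂ M contains no exceptional sphere (π₂(M) = 0 ⇒ zero ω-area ⇒ not symplectic);
McDuff's recognition of MINIMAL PAIRS
(X, L) ≅ (CP², line) [McDuff1990 Thm. 1.4 / Cor. 1.5 (i); McDuffSalamon2017 Rem. 4.5.2 (iv);
book:wendlnd-holomorphic-curves-low-dimensions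
Thm. D (2), PDF p. 21 — the J-curve apex: Fredholm + automatic transversality in dimension 4,
compactness for minimal-energy spheres,
positivity of intersections, evaluation map a diffeomorphism]; control of the identification near L
(symplectic neighbourhood of the
line + Symp(CP², ω_FS) ≃ PU(3) [Gromov1985; McDuffSalamon2017 Rem. 4.5.2 (vii)]) gives Φ = ψ on {R''
< ‖ψ‖ < R'}; the rest of the end is
re-attached by a radial squeeze (no exhaustion, no ball-embedding connectedness, no Cerf Γ₄ — the
symplectic control near L is what replaces
Cerf/Schoenflies at the seam).
SteinSplitV2 ⇐ SympLegendrianHandlebody (signed: every homotopy 4-ball is a Stein domain) →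
RoundBallStein (the closed chart ball
e⁻¹(B̄(e p, ε)) ⊂ Σ is a compact Stein domain with boundary ≃ₜ S³ — the unit ball of ℂ² with φ =
|z|², transported along the chart) →
SteinSplitV2 (W₁ = Σ ∖ open chart ball is compact, contractible, ∂W₁ = the chart sphere; W₂ = the
closed chart ball; seam S³) — k = 2,
to be filed with `route edit --split SteinSplitV2` only when that crux is staffed; below it, the
Legendrian (tb − 1) handlebody mechanism
[Gompf1998 Thm 1.3] once the realisation predicate for
`Literature.Topology.FourManifolds.LegendrianKirbyDiagram` is defined.

KILL CRITERIA. - SympcapThesisV2, SympEndStandard and SteinSplitV2 are each ⟺ SPC4 given the printed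
recognition / filling theorems, so a refutation
  of any of them exhibits an exotic S⁴: `route close --reason refuted:<Decl>` and every positive
route of the summit dies with it.
- GromovRecognitionRelEnd is a theorem in print (Gromov1985 §0.3.C; McDuffSalamon2017 Rem. 4.5.2
(viii)): a Lean refutation of the ITEM
  would mean the tree's reading (MForm/IsClosedForm, π₂ via HomotopyGroup.Pi, the ends clause) is
unfaithful ⇒ class misstated, repair
  by a restated item, never a route close. If instead refuters show that the RELATIVE clause does
not follow from the printed absolute
  theorem plus catalogued results, pivot: re-route through the twisted-sphere form
`gromovMcDuff_isTwistedSphere_of_symplecticStandardNearPoint`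
  + Cerf's Γ₄ = 0 [Cerf1968] at the cost of a Cerf crux (the pre-2026-08-15 assembly; all glue in
tree).
- SympPuncturedStandard refuted (a homotopy sphere with Σ ∖ p ≅ ℝ⁴ but Σ ≇ S⁴) kills only the
chart-free spine (SympEndStandard), not
  closes.
- Mooted if route SchoenfliesSplit or NoOneHandles closes the summit first.

NOT DECOMPOSED YET. - The split of GromovRecognitionRelEnd is foreseen (Two-layer plan) but NOT
filed: D-0019 — one layer of ≤ 3 children, on the crux's
  final cycle only, after provers have banked the linear-algebra / Moser bricks already landing
under it (GromovR4RelEndProofs.lean: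
  symplectic basis theorem p37059, linear Darboux, pointwise normal form).
- Which construction produces the form in X (Weinstein handle-by-handle on a Stein bisection, a
Kähler potential, an h-principle with
  controlled end) — below crux level until SympcapThesisV2 or SteinSplitV2 moves.
- The Legendrian-handlebody strengthening of SteinSplitV2 is now the SIGNED support item
SympLegendrianHandlebody (stmt-SmoothPoincare4-0430:
  every homotopy 4-ball is a Stein domain — by Gompf1998 Thm 1.3 the same proposition as 'has a
3-handle-free Legendrian (tb − 1) Kirby
  diagram'); the diagrammatic layer itself (realisation predicate for
Literature.Topology.FourManifolds.LegendrianKirbyDiagram, handle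
  slides, the framing inequality) stays below item level until SteinSplitV2 is staffed and split
(Two-layer plan).
- The Stein spine's own apex (Eliashberg: Stein fillings of (S³, ξ_std) are B⁴) is not an item: it
is filed only if SteinSplitV2 moves.

CHEAPEST FALSIFIER. For the open items nothing is cheaper than SPC4 itself (each is ⟺ SPC4 under a
printed theorem; refuters confirmed 'no refutation
short of an exotic S⁴' on 0518/0508). Crux GromovRecognitionRelEnd: instantiations, run in tree
(GromovR4RelEndProofs.lean) — the standard
model (ℝ⁴, ω₀, ψ = id, K = B̄(0,1)) satisfies every hypothesis and the conclusion
(`gromov_recognitionR4_relEnd.apply_stdModel`); next, M =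
ℝ⁴ ∖ B̄(0,1) with K = ∅ (connected, π₂ = 0, NOT ≅ ℝ⁴) must FAIL the ends clause `IsCompact (K ∪ {‖ψ‖
≤ R'})`, and does — were it to pass,
the item would be misstated. Target X: its faithfulness check is SETTLED in tree — every smooth
4-manifold diffeomorphic to S⁴ (e.g. the
round sphere with Mathlib's stereographic atlas, punctured anywhere) satisfies X for its own chart
at p
(`Literature.Geometry.Symplectic.exists_isSymplecticStandardNearPoint_of_nonempty_diffeomorph_sphere`
via Palais' chart form
`palais_puncturedSphere_chartForm_holds`, sorry-free; = SPC4 ⇒ X), so X ⟺ SPC4 is kernel-checked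
modulo GromovRecognitionRelEnd and no
falsifier of X cheaper than an exotic S⁴ remains (planner sketch folder/sk/Sketch.lean re-derives
the round-sphere instance, rc 0).

DEFINITION REQUESTS. None new. From the survey: LegendrianKirbyDiagram / Thurston–Bennequin number —
the combinatorial layer landed 2026-08-14
(Literature.Topology.FourManifolds.LegendrianKirbyDiagram: tb, rot, framing = tb − 1, handleCount);
the realisation predicate ('X is the
handlebody attached along the realised Legendrian link with those framings') is still undefined and
is NOT re-requested here (needed only
below the signed support SympLegendrianHandlebody, after a split of SteinSplitV2). Literature
acquisition: McDuff–Salamon, J-holomorphic Curves and Symplectic Topology (2012) §9.4–9.5 —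
acq-00635
(cite-only).

Novelty: Searches (2026-08-15, two repair seats on this route; the 2026-08-16 badge-repair seat ran no new
literature search — item-name sync and the in-tree check 'SPC4 ⇒ X proved' only): `lit search
--hybrid "symplectic structure standard at infinity exotic R4 homotopy 4-sphere Gromov recognition"`
(15 held docs; relevant: book:mcduff2017-introduction-symplectic-topology — READ PDF p. 193 Rem.
4.5.2 (viii) (the relative recognition theorem, vendored as gromov_recognitionR4_relEnd) and pp.
516–521 §13.2 (extension problem 'rather little is known'; exotic SYMPLECTIC structures on ℝ²ⁿ,
nothing on smooth exotica); book:kirby1989-topology-4-manifolds (exotic ℝ⁴ Ch. XIV; Schoenflies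
'wide open' p. 14)); `lit search --hybrid "symplectic form standard at infinity homotopy 4-sphere
recognition of R4 Gromov exotic"` (this seat, vector leg: 10 books, again only McDuffSalamon2017 pp.
520/630 relevant, plus gordon1984-four-manifold-theory p. 8 (problem list) — no paper using a
symplectic certificate for SPC4); `lit search --hybrid "uncountably many exotic R4 admit Stein
structures Gompf handlebody"` (8 held, none primary); `lit search --source arxiv "Stein exotic R4
standard at infinity symplectic filling three-sphere"` (0) and `--source arxiv "Stein structure
homotopy 4-ball exotic 4-sphere symplectic filling S^3"` (0; OpenAlex/S2 rate-limited this hour);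
`lit galaxy search "exotic 4-sphere symplectic" --star all` (0), `"symplectic form which is standard
at infinity" --star all` (0, re-run this  [refs: 2412.04768, 2603.23717, 2601.08767, 2603.05664, math/0010166, book:mcduff2017-introduction-symplectic-topology, book:kirby1989-topology-4-manifolds, McDuffSalamon2017, Gromov1985, McDuff1990, Eliashberg1990, AkbulutMatveyev1998, Gompf1998]

Barriers (technique_class: symplectic-recognition, end-standard-form, stein-filling): - technique_class: symplectic-recognition, end-standard-form, stein-filling
- Literature.Barriers.SmoothPoincare4.OpenAnalogueBarrierFour: evaded by design — the certificate is
not 'Σ ∖ p embeds in, or is homeomorphic to, ℝ⁴' (exotic open subsets of ℝ⁴ and of S⁴ exist,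
DeMichelisFreedman1992) but a symplectic form STANDARD ON THE END, which Gromov's theorem (crux
GromovRecognitionRelEnd = gromov_recognitionR4_relEnd verbatim) converts into a diffeomorphism with
ℝ⁴ agreeing with the end chart; an exotic open ℝ⁴ ⊂ ℝ⁴ carries ω₀ but is not standard at infinity
for any co-compact end, so the barrier's witnesses never satisfy the hypothesis of X or of
SympEndStandard.
- Literature.Barriers.SmoothPoincare4.ContractibleBarrierFour: not met — SteinSplitV2 and the
filling step use S³-SPECIFIC rigidity (unique tight structure, fillings of ξ_std are B⁴); for other
homology-sphere boundaries contractible Stein fillings are neither unique nor standard (corks are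
Stein), and the line never argues 'contractible + same boundary ⇒ diffeomorphic'; conceded: no
general 'contractible Stein ⇒ ball' lemma can carry SteinSplitV2, all weight is on the seam being
S³.
- Literature.Barriers.SmoothPoincare4.RelativeContractibleBarrierFour: not met — no boundary
diffeomorphism is extended over a contractible piece; the chart-end glue inside closes is the double
D⁴ ∪_id D⁴ and uniqueness of gluing two discs along the SAME map (proved in tree,
nonempty_diffeomorph_sphere_of_agreesWithInvertedChartNear), Ce

History (route lifecycle, newest last):
- 2026-08-16T06:11:13Z · AUTO-CRUX (edit): SympcapThesisV2 — hypotheses of the deciding theorem that nothing in the route derives are cruxes (planner-rbadge-SmoothPoincare4-SymplecticCap-cc52b1f9-g3-0)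
- 2026-08-17T00:17:14Z · LINT AUTOFIX route.multi-assembly: kept Assembly, dropped Assembly2, Assembly3, None (gate:hygiene)
- 2026-08-26T07:15:46Z · DORMANT — reconciler: no traction for 8.4 d (last activity item-proof-filed at 2026-08-17T21:04:10Z); parked, not closed — `ledger route dormant route-SmoothPoincare4-Sym (operator:999:3616278)
- 2026-08-30T17:13:47Z · REACTIVATED (open) — reconciler: reactivated — activity statement-checked at 2026-08-30T16:13:55Z after parking at 2026-08-26T07:15:46Z (operator:999:675198)
- 2026-09-04T19:06:12Z · DORMANT — reconciler: no traction for 5 d (last activity statement-checked at 2026-08-30T18:05:45Z); parked, not closed — `ledger route dormant route-SmoothPoincare4-Symp (operator:999:2445985)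

sub-problem: SmoothPoincare4 · status: dormant · opened planner-SmoothPoincare4-Survey-0 2026-08-13T06:34:48Z · rev 18 · ledger route-SmoothPoincare4-SymplecticCap
GENERATED by the gate from the ledger (D-0016/17). Provers cite these decls: `theorem foo : Summit.SmoothPoincare4.SmoothPoincare4.Theses.SymplecticCap.<Decl> := …` in Summits/SmoothPoincare4/SmoothPoincare4/Theorems/<Name>.lean.
-/

namespace Summit.SmoothPoincare4.SmoothPoincare4.Theses.SymplecticCap

open scoped BigOperators Topology Manifold Classical MeasureTheory ProbabilityTheory Matrix InnerProductSpace ComplexConjugate ContinuousMap ContDiff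
open Filter Set Function TopologicalSpace MeasureTheory

attribute [summit_statement] _root_.SmoothPoincare4

open Literature.SPC4

/-- item stmt-SmoothPoincare4-0518 · crux (kind.auto-crux: conjecture-grade) · rank 0 · open · by planner
why it might fail: X ⟺ SPC4 given Gromov's recognition theorem (⇐ proved in tree: exists_isSymplecticStandardNearPoint_of_nonempty_diffeomorph_sphere; ⇒ = closes), so X is false iff an exotic 4-sphere exists; no construction of a symplectic form with prescribed END germ is known.
sources: Gromov1985, McDuffSalamon2017, McDuff1990, Gromov1986, EliashbergMishachev2002
defn-IsSymplecticStandardNearPoint is DONE (Literature/Geometry/Symplectic/StandardEnd.lean):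
Literature.Geometry.Symplectic.punctured p : Opens M ({p}ᶜ);
Literature.Geometry.Symplectic.IsSymplecticStandardNearPoint p ε sf := 0 < ε ∧ IsSmoothForm sf ∧
IsClosedForm sf ∧ (pointwise nondegenerate) ∧ (on the punctured chart-ball of radius ε about p, sf =
invertedStdForm (e x − e p) on De-images, e = extChartAt (𝓡 4) p, invertedStdForm y a b = ω₀(Dι(y)a,
Dι(y)b), ι z = (‖z‖²)⁻¹ • z, ω₀ = dx₀∧dx₁ + dx₂∧dx₃);
Literature.Geometry.Symplectic.AgreesWithInvertedChartNear p Φ := ∃ ε > 0, Φ = ι ∘ (e − e p) on that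
punctured ball. The definer made the bodies literally the sub-terms of stmt-SmoothPoincare4-0427
(isSymplecticStandardNearPoint_iff : … ↔ verbatim-0427-matrix := Iff.rfl), so THIS ITEM AND 0427 ARE
THE SAME PROPOSITION up to δ-unfolding; it is filed so that facts/assemblies fit on one line and
cite the packaged name. 0427 (checked) is not withdrawn; whichever the refuter keeps, the other is
discharged by `exact h` / `fun S p => h S p`. Content recap: every homotopy 4-sphere minus a point
carries a symplectic form standard at infinity in the chart at p (Gromov1985 §0.3.C asymptotically -/
@[route_item "route-SmoothPoincare4-SymplecticCap"]
def SympcapThesisV2 : Prop :=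
  ∀ (S : Literature.Topology.FourManifolds.HomotopySphere 4) (p : S.carrier), ∃ (ε : ℝ) (sf : Literature.Geometry.Kaehler.MForm (𝓡 4) (Literature.Geometry.Symplectic.punctured p) ℝ 2), Literature.Geometry.Symplectic.IsSymplecticStandardNearPoint p ε sf

/-- item stmt-SmoothPoincare4-0508 · crux · rank 2 · open · by planner
why it might fail: ⟺ SPC4 given Eliashberg's filling theorem; constructively it needs a Stein structure on an arbitrary homotopy 4-ball, and the only known source (Eliashberg–Gompf Legendrian 2-handles with framing tb−1) presupposes a 3-handle-free decomposition of Σ (open, route NoOneHandles) AND realisable framings.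
sources: AkbulutMatveyev1998, Eliashberg1990, Eliashberg1992, Gompf1998, Eliashberg1990Stein, CieliebakEliashberg2012
SUPERSEDES the informal stmt-SmoothPoincare4-0429: defn-IsSteinDomain is DONE
(Literature/Geometry/Symplectic/SteinDomain.lean: Literature.Geometry.Symplectic.SteinStructure W =
integrable almost complex J (Nijenhuis = 0 via Mathlib mlieBracket) + smooth J-convex φ with ∂W its
regular maximal level set; Literature.Geometry.Symplectic.IsSteinDomain W := Nonempty
(SteinStructure W), W compact modelled on 𝓡∂ 4; also
Literature.Geometry.Symplectic.IsLiouvilleDomain W lam). Statement: ∀ Σ :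
Literature.Topology.FourManifolds.HomotopySphere 4, ∃ compact W₁ W₂ (𝓡∂ 4-manifolds) and smooth
embeddings eᵢ : Wᵢ ↪ Σ with IsSteinDomain W₁ ∧ IsSteinDomain W₂, range e₁ ∪ range e₂ = Σ, range e₁ ∩
range e₂ = e₁(∂W₁) = e₂(∂W₂), and ∂W₁ ≃ₜ S³. As answered to grounder-A in session 4: the separating
Y MUST be S³ — for general Y the splitting Σ = Stein ∪_Y Stein is a THEOREM for every closed
oriented smooth 4-manifold [AkbulutMatveyev1998 Thm 1] and carries no information. No orientation
compatibility between the two Stein structures and Σ is imposed (AM's second piece is Stein with the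
opposite orientation; irrelevant here since both pieces turn out to be balls). Assembly (informal
0444-style, all inputs -/
@[route_item "route-SmoothPoincare4-SymplecticCap"]
def SteinSplitV2 : Prop :=
  ∀ S : Literature.Topology.FourManifolds.HomotopySphere 4, ∃ (W₁ : Type) (_ : TopologicalSpace W₁) (_ : ChartedSpace (EuclideanHalfSpace 4) W₁) (_ : IsManifold (𝓡∂ 4) ∞ W₁) (_ : CompactSpace W₁) (W₂ : Type) (_ : TopologicalSpace W₂) (_ : ChartedSpace (EuclideanHalfSpace 4) W₂) (_ : IsManifold (𝓡∂ 4) ∞ W₂) (_ : CompactSpace W₂) (e₁ : W₁ → S.carrier) (e₂ : W₂ → S.carrier), Literature.Geometry.Symplectic.IsSteinDomain W₁ ∧ Literature.Geometry.Symplectic.IsSteinDomain W₂ ∧ Manifold.IsSmoothEmbedding (𝓡∂ 4) (𝓡 4) ∞ e₁ ∧ Manifold.IsSmoothEmbedding (𝓡∂ 4) (𝓡 4) ∞ e₂ ∧ Set.range e₁ ∪ Set.range e₂ = Set.univ ∧ Set.range e₁ ∩ Set.range e₂ = e₁ '' (𝓡∂ 4).boundary W₁ ∧ Set.range e₁ ∩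 Set.range e₂ = e₂ '' (𝓡∂ 4).boundary W₂ ∧ Nonempty ((𝓡∂ 4).boundary W₁ ≃ₜ Metric.sphere (0 : EuclideanSpace ℝ (Fin 4)) 1)

/-- item stmt-SmoothPoincare4-8775 · crux · rank 2 · open · by planner
why it might fail: under the fact it asserts Σ∖p ≅ ℝ⁴ for every homotopy 4-sphere — open (GompfStipsicz1999 §9.4): an exotic ℝ⁴ with a smooth product end S³×[0,∞) would puncture an exotic Σ and refute it; and no method makes a symplectic form standard on a prescribed END of a contractible 4-manifold.
sources: McDuffSalamon2017, Gromov1985, GompfStipsicz1999, Gompf1998, DeMichelisFreedman1992, Mazur1959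
[crux] CHART-FREE form of X — for every homotopy 4-sphere Σ and p ∈ Σ there are a smooth closed
nondegenerate 2-form sf on Σ ∖ p, a compact K ⊆ Σ ∖ p, R, and a bijection ψ of (Σ ∖ p) ∖ K onto {z ∈
ℝ⁴ : R < ‖z‖} (C^∞ with C^∞ inverse χ, every sub-end {R' < ‖ψ‖} co-compact) with sf = ψ*ω₀ there;
i.e. (Σ ∖ p, sf) is symplectomorphic near its end to a neighbourhood of infinity of (ℝ⁴, ω₀) for
SOME end parametrisation — binders 8–16 of `gromov_recognitionR4_relEnd` with M := punctured p,
verbatim. Under the fact it is equivalent to Σ ∖ p ≅ ℝ⁴, i.e. to 'the homotopy ball Σ ∖ B̊ is a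
Schoenflies ball' (Mazur); X implies it (ψ = ι ∘ (e − e p), support ThesisGivesEndStandard) and
together with SympPuncturedStandard it gives SPC4 (RouteCloses, proof compiled). [difficulty:
open-problem] — why it might fail: under the fact it asserts Σ∖p ≅ ℝ⁴ for every homotopy 4-sphere —
open (GompfStipsicz1999 §9.4): an exotic ℝ⁴ with a smooth product end S³×[0,∞) would puncture an
exotic Σ and refute it; and no method makes a symplectic form standard on a prescribed END of a
contractible 4-manifold. — sources: McDuffSalamon2017, Gromov1985, GompfStipsicz1999, Gompf1998,
DeMichelisFreedman1992, Mazur1959 -/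
@[route_item "route-SmoothPoincare4-SymplecticCap"]
def SympEndStandard : Prop :=
  ∀ (S : Literature.Topology.FourManifolds.HomotopySphere 4) (p : S.carrier), ∃ (sf : Literature.Geometry.Kaehler.MForm (𝓡 4) (Literature.Geometry.Symplectic.punctured p) ℝ 2) (K : Set (Literature.Geometry.Symplectic.punctured p)) (R : ℝ) (ψ : Literature.Geometry.Symplectic.punctured p → EuclideanSpace ℝ (Fin 4)) (χ : EuclideanSpace ℝ (Fin 4) → Literature.Geometry.Symplectic.punctured p), Literature.Geometry.Kaehler.IsSmoothForm sf ∧ Literature.Geometry.Kaehler.IsClosedForm sf ∧ (∀ x (v : TangentSpace (𝓡 4) x), v ≠ 0 → ∃ w, sf x ![v, w] ≠ 0) ∧ (∀ R', R ≤ R' → IsCompact (K ∪ {x | ‖ψ x‖ ≤ R'})) ∧ ContMDiffOn (𝓡 4) 𝓘(ℝ, EuclideanSpace ℝ (Fin 4)) ∞ ψ Kᶜ ∧ ContMDiffOn 𝓘(ℝ, EuclideanSpace ℝ (Fin 4)) (𝓡 4) ∞ χ (Metric.closedBall (0 : EuclideanSpace ℝ (Fin 4)) R)ᶜ ∧ Set.BijOn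 ψ Kᶜ (Metric.closedBall (0 : EuclideanSpace ℝ (Fin 4)) R)ᶜ ∧ (∀ x, x ∈ Kᶜ → χ (ψ x) = x) ∧ (∀ x, x ∈ Kᶜ → ∀ v w, sf x ![v, w] = Literature.Geometry.Symplectic.stdSymplecticForm (mfderiv (𝓡 4) 𝓘(ℝ, EuclideanSpace ℝ (Fin 4)) ψ x v) (mfderiv (𝓡 4) 𝓘(ℝ, EuclideanSpace ℝ (Fin 4)) ψ x w))

/-- item stmt-SmoothPoincare4-11009 · crux · rank 3 · open · by planner
why it might fail: True in print, but the RELATIVE clause (Φ = ψ off a compact set) is printed only as MS2017 Rem 4.5.2(viii) without proof (detailed exposition MS2012 §9.4 not held, acq-00635): J-curve coordinates need an extra extension/Symp_c(ℝ⁴,ω₀) step; and Lean has no J-holomorphic-curve theory at all (XL).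
sources: McDuffSalamon2017, Gromov1985, McDuffSalamon2012, McDuff1990, book:mcduff2017-introduction-symplectic-topology, book:wendlnd-holomorphic-curves-low-dimensions
[crux] NEW (promoted fact, by name): Gromov's recognition of (ℝ⁴, ω₀) relative at infinity — a
connected symplectic 4-manifold (M, ω) with π₂(M) = 0 which outside a compact set is
symplectomorphic (ψ) to a neighbourhood of infinity of (ℝ⁴, ω₀) (ends clause: every sub-end
co-compact) is symplectomorphic to (ℝ⁴, ω₀) by a Φ equal to ψ outside a compact set
[McDuffSalamon2017 Rem. 4.5.2 (viii) verbatim; Gromov1985 §0.3.C, 2.4.A₂′]. The Lean item IS the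
audited Literature statement `Literature.Geometry.Symplectic.gromov_recognitionR4_relEnd` (refuter
audit: faithful; non-vacuity `gromov_recognitionR4_relEnd.apply_stdModel` in tree); a proof of
either name closes it. Load-bearing in closes. [difficulty: XL] — why it might fail: True in print,
but the RELATIVE clause (Φ = ψ off a compact set) is printed only as MS2017 Rem 4.5.2(viii) without
proof (detailed exposition MS2012 §9.4 not held, acq-00635): J-curve coordinates need an extra
extension/Symp_c(ℝ⁴,ω₀) step; and Lean has no J-holomorphic-curve theory at all (XL). — sources:
McDuffSalamon2017, Gromov1985, McDuffSalamon2012, McDuff1990,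
book:mcduff2017-introduction-symplectic-topology, book:wendlnd-holomorphic-curves-low-dimensions -/
@[route_item "route-SmoothPoincare4-SymplecticCap"]
def GromovRecognitionRelEnd : Prop :=
  ∀ (M : Type) [TopologicalSpace M] [T2Space M] [SecondCountableTopology M] [ChartedSpace (EuclideanSpace ℝ (Fin 4)) M] [IsManifold (𝓡 4) ∞ M] [ConnectedSpace M] (sf : Literature.Geometry.Kaehler.MForm (𝓡 4) M ℝ 2) (K : Set M) (R : ℝ) (ψ : M → EuclideanSpace ℝ (Fin 4)) (χ : EuclideanSpace ℝ (Fin 4) → M), (∀ x : M, Subsingleton (π_ 2 M x)) → Literature.Geometry.Kaehler.IsSmoothForm sf → Literature.Geometry.Kaehler.IsClosedForm sf → (∀ x (v : TangentSpace (𝓡 4) x), v ≠ 0 → ∃ w, sf x ![v, w] ≠ 0) → (∀ R', R ≤ R' → IsCompact (K ∪ {x | ‖ψ x‖ ≤ R'})) → ContMDiffOn (𝓡 4) 𝓘(ℝ, EuclideanSpace ℝ (Fin 4)) ∞ ψ Kᶜ → ContMDiffOn 𝓘(ℝ, EuclideanSpace ℝ (Fin 4)) (𝓡 4) ∞ χ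 (Metric.closedBall (0 : EuclideanSpace ℝ (Fin 4)) R)ᶜ → Set.BijOn ψ Kᶜ (Metric.closedBall (0 : EuclideanSpace ℝ (Fin 4)) R)ᶜ → (∀ x, x ∈ Kᶜ → χ (ψ x) = x) → (∀ x, x ∈ Kᶜ → ∀ v w, sf x ![v, w] = Literature.Geometry.Symplectic.stdSymplecticForm (mfderiv (𝓡 4) 𝓘(ℝ, EuclideanSpace ℝ (Fin 4)) ψ x v) (mfderiv (𝓡 4) 𝓘(ℝ, EuclideanSpace ℝ (Fin 4)) ψ x w)) → ∃ Φ : M ≃ₘ⟮𝓡 4, 𝓡 4⟯ EuclideanSpace ℝ (Fin 4), (∀ x v w, sf x ![v, w] = Literature.Geometry.Symplectic.stdSymplecticForm (mfderiv (𝓡 4) 𝓘(ℝ, EuclideanSpace ℝ (Fin 4)) Φ x v) (mfderiv (𝓡 4) 𝓘(ℝ, EuclideanSpace ℝ (Fin 4)) Φ x w)) ∧ ∃ K' : Set M, IsCompact K' ∧ ∀ x, x ∉ K' → Φ x = ψ x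

/-- item stmt-SmoothPoincare4-16777 · crux · rank 3 · open · by planner
why it might fail: Printed for tame J, compact X (Gromov1985 1.5.B; McDuffSalamon2012 Thm 5.3.1/5.2.2; Wendl2018 Thm 4.6, PDF p.114); the DICHOTOMY packaging is this tree's reading (one vertex ⇒ uniform convergence after LINEAR reparametrisation; Hausdorff clause), may be mis-typed; no bubbling theory in Mathlib: XL.
sources: Gromov1985, McDuffSalamon2012, Hummel1997, Wendl2018, book:wendlnd-holomorphic-curves-low-dimensions
[crux] PROMOTED named fact (same route-choice; Gromov compactness is the largest fact of the
skeleton and cannot be inlined by any fact seat) =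
Literature.Geometry.Symplectic.gromovCompactness_spheres_dichotomy transcribed VERBATIM (Iff.rfl,
sk/Sketch.lean): X a compact 4-manifold, JX tamed by a closed smooth 2-form, (uₙ, vₙ) JX-holomorphic
two-chart spheres whose glued maps Fₙ : ℂℙ¹ → X are all homotopic to a fixed F₀ (so the energy is
constant); along a subsequence EITHER (A) Fₙ ∘ [Aₙ] → F uniformly for some linear reparametrisations
Aₙ ∈ GL₂(ℂ) of ℂℙ¹ and a JX-sphere (u, v) with glued map F (the limit stable tree has one vertex: a
tree whose other vertices are ghosts is that vertex alone, by stability), OR (B) there are m ≥ 2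
NON-constant JX-spheres whose glued fundamental classes add up to that of the Fₙ in H₂(X; ℤ) and
whose images are the Hausdorff limit of the images (Gromov 1985 1.5.B; McDuff–Salamon 2012 Thm 5.3.1
with Def. 5.1.1 and Thm 5.2.2; Hummel 1997 Ch. V; Wendl 2018 Thm 4.6). It IS stub_factCompactness
(F2) of Lines/cross_cap_laurent.lean — the CLOSEDNESS input of the core. Feeds
GromovRecognitionRelEnd through GromovRecognitionRelEndOfJCurveFacts. Difficulty XL-ap -/
@[route_item "route-SmoothPoincare4-SymplecticCap"]
def GromovCompactnessSpheres : Prop :=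
  ∀ (X : Type) [TopologicalSpace X] [T2Space X] [SecondCountableTopology X] [CompactSpace X] [ChartedSpace (EuclideanSpace ℝ (Fin 4)) X] [IsManifold (𝓡 4) ∞ X] (ωX : Literature.Geometry.Kaehler.MForm (𝓡 4) X ℝ 2) (JX : Literature.Geometry.Symplectic.AlmostComplexStructure (𝓡 4) ∞ X) (us vs : ℕ → ℂ → X) (Fs : ℕ → C(Literature.Topology.FourManifolds.ComplexProjectiveSpace 1, X)) (F₀ : C(Literature.Topology.FourManifolds.ComplexProjectiveSpace 1, X)), Literature.Geometry.Kaehler.IsSmoothForm ωX → Literature.Geometry.Kaehler.IsClosedForm ωX → JX.IsTamedBy ωX → (∀ n, ContMDiff 𝓘(ℝ, ℂ) (𝓡 4) ∞ (us n) ∧ ContMDiff 𝓘(ℝ, ℂ) (𝓡 4) ∞ (vs n) ∧ (∀ z : ℂ, z ≠ 0 → vs n z = us n z⁻¹) ∧ Literature.Geometry.Symplectic.IsJHolomorphic (𝓡 4) (fun y => JX y) (us n) ∧ Literature.Geometry.Symplectic.IsJHolomorphic (𝓡 4) (fun y => JX y) (vs n) ∧ (∀ p, Literature.Topology.FourManifolds.ComplexProjectiveSpace.CoordNeZero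 0 p → Fs n p = us n (Literature.Topology.FourManifolds.ComplexProjectiveSpace.affineCoordComplex 0 p 0)) ∧ (∀ p, Literature.Topology.FourManifolds.ComplexProjectiveSpace.CoordNeZero 1 p → Fs n p = vs n (Literature.Topology.FourManifolds.ComplexProjectiveSpace.affineCoordComplex 1 p 0)) ∧ (Fs n).Homotopic F₀) → ∃ φ : ℕ → ℕ, StrictMono φ ∧ ((∃ (u v : ℂ → X) (F : C(Literature.Topology.FourManifolds.ComplexProjectiveSpace 1, X)) (A : ℕ → ((Fin 2 → ℂ) ≃ₗ[ℂ] (Fin 2 → ℂ))), ContMDiff 𝓘(ℝ, ℂ) (𝓡 4) ∞ u ∧ ContMDiff 𝓘(ℝ, ℂ) (𝓡 4) ∞ v ∧ (∀ z : ℂ, z ≠ 0 → v z = u z⁻¹) ∧ Literature.Geometry.Symplectic.IsJHolomorphic (𝓡 4) (fun y => JX y) u ∧ Literature.Geometry.Symplectic.IsJHolomorphic (𝓡 4) (fun y => JX y) v ∧ (∀ p, Literature.Topology.FourManifolds.ComplexProjectiveSpace.CoordNeZero 0 p → F p = u (Literature.Topology.FourManifolds.ComplexProjectiveSpace.affineCoordComplex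 0 p 0)) ∧ (∀ p, Literature.Topology.FourManifolds.ComplexProjectiveSpace.CoordNeZero 1 p → F p = v (Literature.Topology.FourManifolds.ComplexProjectiveSpace.affineCoordComplex 1 p 0)) ∧ Filter.Tendsto (fun k => (Fs (φ k)).comp ⟨Literature.Geometry.Symplectic.PlusOneSpherePair.projectiveMap (A k), Literature.Geometry.Symplectic.PlusOneSpherePair.continuous_projectiveMap (A k)⟩) Filter.atTop (𝓝 F)) ∨ (∃ (m : ℕ) (Bu Bv : Fin m → ℂ → X) (G : Fin m → C(Literature.Topology.FourManifolds.ComplexProjectiveSpace 1, X)), 2 ≤ m ∧ (∀ j, ContMDiff 𝓘(ℝ, ℂ) (𝓡 4) ∞ (Bu j) ∧ ContMDiff 𝓘(ℝ, ℂ) (𝓡 4) ∞ (Bv j) ∧ (∀ z : ℂ, z ≠ 0 → Bv j z = Bu j z⁻¹) ∧ Literature.Geometry.Symplectic.IsJHolomorphic (𝓡 4) (fun y => JX y) (Bu j) ∧ Literature.Geometry.Symplectic.IsJHolomorphic (𝓡 4) (fun y => JX y) (Bv j) ∧ (∃ z, Bu j z ≠ Bu j 0) ∧ (∀ p, Literature.Topology.FourManifolds.ComplexProjectiveSpace.CoordNeZero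 0 p → G j p = Bu j (Literature.Topology.FourManifolds.ComplexProjectiveSpace.affineCoordComplex 0 p 0)) ∧ (∀ p, Literature.Topology.FourManifolds.ComplexProjectiveSpace.CoordNeZero 1 p → G j p = Bv j (Literature.Topology.FourManifolds.ComplexProjectiveSpace.affineCoordComplex 1 p 0))) ∧ (∀ n, ∑ j, Literature.AlgebraicTopology.SingularHomology.singularHomology.map ℤ ℤ (G j) (2 * 1) (Literature.Topology.FourManifolds.ComplexProjectiveSpace.homologicalOrientationInt 1).fundamentalClass = Literature.AlgebraicTopology.SingularHomology.singularHomology.map ℤ ℤ (Fs n) (2 * 1) (Literature.Topology.FourManifolds.ComplexProjectiveSpace.homologicalOrientationInt 1).fundamentalClass) ∧ (∀ O : Set X, IsOpen O → (⋃ j, (Set.range (Bu j) ∪ {Bv j 0})) ⊆ O → ∀ᶠ k in Filter.atTop, Set.range (us (φ k)) ∪ {vs (φ k) 0} ⊆ O) ∧ (∀ y ∈ ⋃ j, (Set.range (Bu j) ∪ {Bv j 0}), ∀ O' : Set X, IsOpen O' → y ∈ O' → ∀ᶠ k in Filter.atTop, ((Set.range (us (φ k)) ∪ {vs (φ k) 0})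 ∩ O').Nonempty)))

/-- item stmt-SmoothPoincare4-0431 · crux · rank 4 · open · by planner
why it might fail: equivalent to the smooth Schoenflies conjecture ('wide open', Kirby1989 p. 14): a non-standard Schoenflies ball A gives Σ = A ∪ D⁴ with Σ∖p ≅ int A ∪ collar ≅ ℝ⁴ yet Σ ≇ S⁴; the analogue one pattern up is false (Σ⁷∖pt ≅ ℝ⁷ for Milnor's exotic Σ⁷), so no soft argument exists.
sources: Mazur1959, Kirby1989, Kirby1997, Palais1960, Cerf1968, GompfStipsicz1999
If the complement of a point in a homotopy 4-sphere is diffeomorphic to ℝ⁴ then Σ ≅ S⁴. Needed by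
the chart-free form of the thesis (a symplectic form on Σ ∖ p standard at infinity for an ARBITRARY
proper end parametrisation gives, via the filling theorem on exhausting sublevel pieces and
Palais–Cerf uniqueness of nested balls, only Σ ∖ p ≅ ℝ⁴). Implied by the smooth Schoenflies
conjecture (route SchoenfliesSplit, stmt-SmoothPoincare4-0372: Σ ∖ chart-ball ⊂ Σ ∖ p ≅ ℝ⁴ ⊂ S⁴ is
then a Schoenflies ball) and by SPC4; planner knows no unconditional proof — the germ of the smooth
structure at p vs the end of ℝ⁴ is exactly a Schoenflies pair (A, B) with B ∖ pt standard. Grounder: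
mark 'known' with a citation if this is folklore-proved. Sources: Palais1960; Cerf1968; Kirby1997
Problems 4.43–4.45 (context); GompfStipsicz1999 §9.4. opens: `open scoped Manifold ContDiff`, `open
ContinuousMap`; imports: Summits.SmoothPoincare4.Statement +
Literature.Topology.FourManifolds.{HomotopySpheres,Morse,BalancedPresentation} +
Literature.Geometry.Kaehler.ManifoldForms. Elaborated 2026-08-13 with plain `lean check` (no
overlay). -/
@[route_item "route-SmoothPoincare4-SymplecticCap"]
def SympPuncturedStandard : Prop :=
  ∀ (S : Literature.Topology.FourManifolds.HomotopySphere 4) (p : S.carrier), Nonempty ((⟨{p}ᶜ, isOpen_compl_singleton⟩ : TopologicalSpace.Opens S.carrier) ≃ₘ⟮𝓡 4, 𝓡 4⟯ EuclideanSpace ℝ (Fin 4)) → Nonempty (S.carrier ≃ₘ⟮𝓡 4, 𝓡 4⟯ Metric.sphere (0 : EuclideanSpace ℝ (Fin 5)) 1)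

/-- item stmt-SmoothPoincare4-16778 · crux · rank 4 · closed · proved by Summit.SmoothPoincare4.SmoothPoincare4.Theorems.LocalFoliationEmbeddedSpheres_proof @ f02c02371af0 (prover) · by planner
why it might fail: Printed (Wendl2018 Prop 2.53 m=0 + Thm 2.49, PDF p.73–74; HoferLizanSikorav1997 Thm 1) but the vendored extras must hold too: leaf a=0 IS (u₀,v₀), immersive evaluation maps on ball×ℂ in both charts, uniqueness for each homotopic sphere meeting the sweep; no Fredholm/IFT on map spaces in Mathlib: XL.
sources: Wendl2018, HoferLizanSikorav1997, McDuffSalamon2012, book:wendlnd-holomorphic-curves-low-dimensions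
[crux] PROMOTED named fact (same route-choice, pre-empting the identical verdict already recorded by
the fact seat of claim 780: 'HLS local foliation audited TRUE but XL') =
Literature.Geometry.Symplectic.hls_localFoliation_embeddedSphere_trivialNormal transcribed VERBATIM
(Iff.rfl, sk/Sketch.lean): in an almost complex 4-manifold (X, JX) an embedded JX-holomorphic
two-chart sphere S = (u₀, v₀) with trivial normal bundle (cut out in an open N by a smooth
submersion π : N → ℂ) is the leaf a = 0 of a jointly smooth one-complex-parameter family (U a, V a),
‖a‖ < ε, of pairwise disjoint embedded JX-spheres sweeping out an open neighbourhood of the image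
with immersive evaluation maps, and every JX-sphere whose glued map is homotopic to that of S and
whose image meets the sweep is one of the leaves (Wendl 2018 Prop. 2.53 with m = 0, via automatic
transversality Thm 2.44/2.46 = Hofer–Lizan–Sikorav 1997 Thm 1; uniqueness clause = positivity of
intersections Thm 2.49 with [S]·[S] = 0). It IS stub_factLocalFoliation (F1) of
Lines/cross_cap_laurent.lean — the OPENNESS input of the core's open–closed argument. Feeds
GromovRecognitionRelEnd through GromovRecognitionRelEndOfJCurveFacts. Difficu -/
@[route_item "route-SmoothPoincare4-SymplecticCap"]
def LocalFoliationEmbeddedSpheres : Prop :=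
  ∀ (X : Type) [TopologicalSpace X] [T2Space X] [SecondCountableTopology X] [ChartedSpace (EuclideanSpace ℝ (Fin 4)) X] [IsManifold (𝓡 4) ∞ X] (JX : Literature.Geometry.Symplectic.AlmostComplexStructure (𝓡 4) ∞ X) (u₀ v₀ : ℂ → X) (N : Set X) (π : X → ℂ), ContMDiff 𝓘(ℝ, ℂ) (𝓡 4) ∞ u₀ → ContMDiff 𝓘(ℝ, ℂ) (𝓡 4) ∞ v₀ → (∀ z : ℂ, z ≠ 0 → v₀ z = u₀ z⁻¹) → Literature.Geometry.Symplectic.IsJHolomorphic (𝓡 4) (fun y => JX y) u₀ → Literature.Geometry.Symplectic.IsJHolomorphic (𝓡 4) (fun y => JX y) v₀ → Function.Injective u₀ → (∀ z, Function.Injective (mfderiv 𝓘(ℝ, ℂ) (𝓡 4) u₀ z)) → Function.Injective (mfderiv 𝓘(ℝ, ℂ) (𝓡 4) v₀ 0) → v₀ 0 ∉ Set.range u₀ → IsOpen N → Set.range u₀ ∪ {v₀ 0} ⊆ N → ContMDiffOn (𝓡 4) 𝓘(ℝ, ℂ) ∞ π N → (∀ y ∈ N, Function.Surjective (mfderiv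 (𝓡 4) 𝓘(ℝ, ℂ) π y)) → {y | y ∈ N ∧ π y = 0} = Set.range u₀ ∪ {v₀ 0} → ∃ (ε : ℝ) (U V : ℂ → ℂ → X), 0 < ε ∧ (∀ z, U 0 z = u₀ z) ∧ (∀ w, V 0 w = v₀ w) ∧ (∀ a : ℂ, ‖a‖ < ε → ContMDiff 𝓘(ℝ, ℂ) (𝓡 4) ∞ (U a) ∧ ContMDiff 𝓘(ℝ, ℂ) (𝓡 4) ∞ (V a) ∧ (∀ z : ℂ, z ≠ 0 → V a z = U a z⁻¹) ∧ Literature.Geometry.Symplectic.IsJHolomorphic (𝓡 4) (fun y => JX y) (U a) ∧ Literature.Geometry.Symplectic.IsJHolomorphic (𝓡 4) (fun y => JX y) (V a) ∧ Function.Injective (U a) ∧ (∀ z, Function.Injective (mfderiv 𝓘(ℝ, ℂ) (𝓡 4) (U a) z)) ∧ Function.Injective (mfderiv 𝓘(ℝ, ℂ) (𝓡 4) (V a) 0) ∧ V a 0 ∉ Set.range (U a)) ∧ ContMDiffOn 𝓘(ℝ, ℂ × ℂ) (𝓡 4) ∞ (fun q : ℂ × ℂ => U q.1 q.2) (Metric.ball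 0 ε ×ˢ Set.univ) ∧ ContMDiffOn 𝓘(ℝ, ℂ × ℂ) (𝓡 4) ∞ (fun q : ℂ × ℂ => V q.1 q.2) (Metric.ball 0 ε ×ˢ Set.univ) ∧ (∀ a a' : ℂ, ‖a‖ < ε → ‖a'‖ < ε → a ≠ a' → Disjoint (Set.range (U a) ∪ {V a 0}) (Set.range (U a') ∪ {V a' 0})) ∧ (∀ q ∈ Metric.ball (0 : ℂ) ε ×ˢ (Set.univ : Set ℂ), Function.Injective (mfderiv 𝓘(ℝ, ℂ × ℂ) (𝓡 4) (fun q : ℂ × ℂ => U q.1 q.2) q) ∧ Function.Injective (mfderiv 𝓘(ℝ, ℂ × ℂ) (𝓡 4) (fun q : ℂ × ℂ => V q.1 q.2) q)) ∧ IsOpen (⋃ a ∈ Metric.ball (0 : ℂ) ε, (Set.range (U a) ∪ {V a 0})) ∧ (∀ (u v : ℂ → X) (F F₀ : C(Literature.Topology.FourManifolds.ComplexProjectiveSpace 1, X)), ContMDiff 𝓘(ℝ, ℂ) (𝓡 4) ∞ u → ContMDiff 𝓘(ℝ, ℂ) (𝓡 4) ∞ v → (∀ z : ℂ, z ≠ 0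 → v z = u z⁻¹) → Literature.Geometry.Symplectic.IsJHolomorphic (𝓡 4) (fun y => JX y) u → Literature.Geometry.Symplectic.IsJHolomorphic (𝓡 4) (fun y => JX y) v → (∀ p, Literature.Topology.FourManifolds.ComplexProjectiveSpace.CoordNeZero 0 p → F p = u (Literature.Topology.FourManifolds.ComplexProjectiveSpace.affineCoordComplex 0 p 0)) → (∀ p, Literature.Topology.FourManifolds.ComplexProjectiveSpace.CoordNeZero 1 p → F p = v (Literature.Topology.FourManifolds.ComplexProjectiveSpace.affineCoordComplex 1 p 0)) → (∀ p, Literature.Topology.FourManifolds.ComplexProjectiveSpace.CoordNeZero 0 p → F₀ p = u₀ (Literature.Topology.FourManifolds.ComplexProjectiveSpace.affineCoordComplex 0 p 0)) → (∀ p, Literature.Topology.FourManifolds.ComplexProjectiveSpace.CoordNeZero 1 p → F₀ p = v₀ (Literature.Topology.FourManifolds.ComplexProjectiveSpace.affineCoordComplex 1 p 0)) → F.Homotopic F₀ → (∃ z a, ‖a‖ < ε ∧ u z ∈ Set.range (U a) ∪ {V a 0}) → ∃ a, ‖a‖ < ε ∧ Set.range u ∪ {v 0} = Set.range (U a) ∪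 {V a 0})

-- `LocalFoliationEmbeddedSpheres` holds: proved by `Summit.SmoothPoincare4.SmoothPoincare4.Theorems.LocalFoliationEmbeddedSpheres_proof` @ f02c02371af0 (its module imports this route file, so no `_holds` link can be stated here).

/-- item stmt-SmoothPoincare4-16775 · crux · rank 5 · open · by planner
why it might fail: Theorem in print (Wendl2018 Cor 2.52/Thm 2.51, PDF p.74; McDuff1991 Thm 1.3); can fail only AS TYPED — one-point somewhere-injectivity (u⁻¹(u z₀)={z₀}, v 0 ≠ u z₀) + homotopy of glued maps must force [u]=[S]; and Lean has no δ-invariant/positivity for NON-immersed J-curves (Micallef–White) — XL.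
sources: Wendl2018, McDuff1991LocalBehaviour, MicallefWhite1995, LeeSmoothManifolds2013, book:wendlnd-holomorphic-curves-low-dimensions
[crux] PROMOTED XL-apex named fact (route-choice rchoice f5064cb7 on the line file
Cruxes/GromovRecognitionRelEnd/Lines/cross_cap_laurent.lean) =
Literature.Geometry.Symplectic.adjunction_embedded_of_somewhereInjective_sphere transcribed VERBATIM
(↔ by Iff.rfl, planner sketch sk/Sketch.lean rc0): in an almost complex 4-manifold (X, JX), a
somewhere-injective JX-holomorphic two-chart sphere (u, v) whose glued map ℂℙ¹ → X is homotopic to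
that of an EMBEDDED JX-sphere S = (u₀, v₀) with trivial normal bundle (S cut out inside an open N by
a smooth submersion π : N → ℂ) is itself embedded, with a trivial-normal-bundle witness (N′, π′).
Wendl 2018 Cor. 2.52 ⇐ Thm. 2.51 (adjunction formula [u]·[u] = 2δ(u) + c₁([u]) − χ(Σ), δ ≥ 0, = 0
iff embedded; McDuff 1991 Thm 1.3; Micallef–White 1995) + tubular neighbourhood theorem (Lee Thm
6.24). It IS the registered stub stub_factAdjunction (F4) of the parent crux
GromovRecognitionRelEnd's picked skeleton Lines/cross_cap_laurent.lean (also a hypothesis of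
stub_coreGlue): a proof of this item closes that stub by `exact`, and `_holds` of the Literature
fact closes this item by `exact`. Feeds GromovRecognitionRelEnd through the glue item GromovRecogni -/
@[route_item "route-SmoothPoincare4-SymplecticCap"]
def AdjunctionEmbeddedSpheres : Prop :=
  ∀ (X : Type) [TopologicalSpace X] [T2Space X] [SecondCountableTopology X] [ChartedSpace (EuclideanSpace ℝ (Fin 4)) X] [IsManifold (𝓡 4) ∞ X] (JX : Literature.Geometry.Symplectic.AlmostComplexStructure (𝓡 4) ∞ X) (u₀ v₀ : ℂ → X) (N : Set X) (π : X → ℂ) (u v : ℂ → X) (F F₀ : C(Literature.Topology.FourManifolds.ComplexProjectiveSpace 1, X)), ContMDiff 𝓘(ℝ, ℂ) (𝓡 4) ∞ u₀ → ContMDiff 𝓘(ℝ, ℂ) (𝓡 4) ∞ v₀ → (∀ z : ℂ, z ≠ 0 → v₀ z = u₀ z⁻¹) → Literature.Geometry.Symplectic.IsJHolomorphic (𝓡 4) (fun y => JX y) u₀ → Literature.Geometry.Symplectic.IsJHolomorphic (𝓡 4) (fun y => JX y) v₀ → Function.Injective u₀ → (∀ z, Function.Injective (mfderiv 𝓘(ℝ,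 ℂ) (𝓡 4) u₀ z)) → Function.Injective (mfderiv 𝓘(ℝ, ℂ) (𝓡 4) v₀ 0) → v₀ 0 ∉ Set.range u₀ → IsOpen N → Set.range u₀ ∪ {v₀ 0} ⊆ N → ContMDiffOn (𝓡 4) 𝓘(ℝ, ℂ) ∞ π N → (∀ y ∈ N, Function.Surjective (mfderiv (𝓡 4) 𝓘(ℝ, ℂ) π y)) → {y | y ∈ N ∧ π y = 0} = Set.range u₀ ∪ {v₀ 0} → ContMDiff 𝓘(ℝ, ℂ) (𝓡 4) ∞ u → ContMDiff 𝓘(ℝ, ℂ) (𝓡 4) ∞ v → (∀ z : ℂ, z ≠ 0 → v z = u z⁻¹) → Literature.Geometry.Symplectic.IsJHolomorphic (𝓡 4) (fun y => JX y) u → Literature.Geometry.Symplectic.IsJHolomorphic (𝓡 4) (fun y => JX y) v → (∀ p, Literature.Topology.FourManifolds.ComplexProjectiveSpace.CoordNeZero 0 p → F p = u (Literature.Topology.FourManifolds.ComplexProjectiveSpace.affineCoordComplex 0 p 0)) → (∀ p, Literature.Topology.FourManifolds.ComplexProjectiveSpace.CoordNeZero 1 p → F p = v (Literature.Topology.FourManifolds.ComplexProjectiveSpace.affineCoordComplex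 1 p 0)) → (∀ p, Literature.Topology.FourManifolds.ComplexProjectiveSpace.CoordNeZero 0 p → F₀ p = u₀ (Literature.Topology.FourManifolds.ComplexProjectiveSpace.affineCoordComplex 0 p 0)) → (∀ p, Literature.Topology.FourManifolds.ComplexProjectiveSpace.CoordNeZero 1 p → F₀ p = v₀ (Literature.Topology.FourManifolds.ComplexProjectiveSpace.affineCoordComplex 1 p 0)) → F.Homotopic F₀ → (∃ z₀ : ℂ, Function.Injective (mfderiv 𝓘(ℝ, ℂ) (𝓡 4) u z₀) ∧ (∀ z, u z = u z₀ → z = z₀) ∧ v 0 ≠ u z₀) → (Function.Injective u ∧ (∀ z, Function.Injective (mfderiv 𝓘(ℝ, ℂ) (𝓡 4) u z)) ∧ Function.Injective (mfderiv 𝓘(ℝ, ℂ) (𝓡 4) v 0) ∧ v 0 ∉ Set.range u) ∧ (∃ (N' : Set X) (π' : X → ℂ), IsOpen N' ∧ Set.range u ∪ {v 0} ⊆ N' ∧ ContMDiffOn (𝓡 4) 𝓘(ℝ, ℂ) ∞ π' N' ∧ (∀ y ∈ N', Function.Surjective (mfderiv (𝓡 4) 𝓘(ℝ, ℂ) π'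 y)) ∧ {y | y ∈ N' ∧ π' y = 0} = Set.range u ∪ {v 0})

/-- item stmt-SmoothPoincare4-0427 · support · rank 0 · open · by planner
For every homotopy 4-sphere Σ and p ∈ Σ there are ε > 0 and a smooth closed nondegenerate 2-form sf
on Σ ∖ p (`Literature.Geometry.Kaehler.MForm`, `IsSmoothForm`, `IsClosedForm`; nondegeneracy
pointwise) which on {x ≠ p in the chart source, e x ∈ ball(e p, ε)}, e = extChartAt (𝓡 4) p, equals
the pullback along e of ι*ω₀ centred at e p, where ω₀(a,b) = a₀b₁ − a₁b₀ + a₂b₃ − a₃b₂ and ι(z) =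
z/‖z‖² (so (Σ ∖ p, sf) is symplectically standard at infinity, end parametrised by a chart ball).
SPC4 ⇒ thesis (S⁴ ∖ p = ℂ² with stereographic chart). Sources: Gromov1985 §0.3.C; McDuff1990 Thm
1.7; Eliashberg1990 Thm 5.1. opens: `open scoped Manifold ContDiff`, `open ContinuousMap`; imports:
Summits.SmoothPoincare4.Statement +
Literature.Topology.FourManifolds.{HomotopySpheres,Morse,BalancedPresentation} +
Literature.Geometry.Kaehler.ManifoldForms. Elaborated 2026-08-13 with plain `lean check` (no
overlay). -/
@[route_item "route-SmoothPoincare4-SymplecticCap"]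
def SympThesis : Prop :=
  ∀ (S : Literature.Topology.FourManifolds.HomotopySphere 4) (p : S.carrier), ∃ (ε : ℝ) (sf : Literature.Geometry.Kaehler.MForm (𝓡 4) (⟨{p}ᶜ, isOpen_compl_singleton⟩ : TopologicalSpace.Opens S.carrier) ℝ 2), 0 < ε ∧ Literature.Geometry.Kaehler.IsSmoothForm sf ∧ Literature.Geometry.Kaehler.IsClosedForm sf ∧ (∀ x (v : TangentSpace (𝓡 4) x), v ≠ 0 → ∃ w, sf x ![v, w] ≠ 0) ∧ ∀ (x : (⟨{p}ᶜ, isOpen_compl_singleton⟩ : TopologicalSpace.Opens S.carrier)), x.1 ∈ (chartAt (EuclideanSpace ℝ (Fin 4)) p).source → extChartAt (𝓡 4) p x.1 ∈ Metric.ball (extChartAt (𝓡 4) p p) ε → ∀ v w, sf x ![v, w] = (fun (y a b : EuclideanSpace ℝ (Fin 4)) => (fun a' b' : EuclideanSpace ℝ (Fin 4) => a' 0 * b' 1 - a' 1 * b' 0 + a' 2 * b' 3 - a' 3 * b' 2) (fderiv ℝ (fun z : EuclideanSpace ℝ (Fin 4) => (‖z‖ ^ 2)⁻¹ • z) y a)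 (fderiv ℝ (fun z : EuclideanSpace ℝ (Fin 4) => (‖z‖ ^ 2)⁻¹ • z) y b)) (extChartAt (𝓡 4) p x.1 - extChartAt (𝓡 4) p p) (mfderiv (𝓡 4) 𝓘(ℝ, EuclideanSpace ℝ (Fin 4)) (fun z : (⟨{p}ᶜ, isOpen_compl_singleton⟩ : TopologicalSpace.Opens S.carrier) => extChartAt (𝓡 4) p z.1) x v) (mfderiv (𝓡 4) 𝓘(ℝ, EuclideanSpace ℝ (Fin 4)) (fun z : (⟨{p}ᶜ, isOpen_compl_singleton⟩ : TopologicalSpace.Opens S.carrier) => extChartAt (𝓡 4) p z.1) x w)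

/-- item stmt-SmoothPoincare4-0429 · support · rank 2 · open · by planner
INFORMAL (needs_definition: IsSteinDomain — compact complex surface-with-boundary W with strictly
plurisubharmonic exhaustion / strictly pseudoconvex boundary; equivalently a Weinstein domain).
Statement: ∀ Σ : HomotopySphere 4, ∃ smoothly embedded S³ ⊂ Σ with closed complementary components
W₁, W₂ such that each W_i (with the appropriate orientation) admits a Stein domain structure.
AkbulutMatveyev1998 Thm 1: every closed smooth oriented 4-manifold is W₁ ∪_Y W₂ with W_i Stein for
SOME Y; the crux is Y = S³. Alone implies SPC4: the induced contact structures on S³ are tight hence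
standard [Eliashberg1992 Thm 2.1.1], Stein fillings of (S³, ξ_std) are B⁴ [Eliashberg1990 Thm 5.1;
McDuff1990 Thm 1.7], twisted spheres are standard [Cerf1968]. Weaker than #0 (there W₂ is a chart
ball). Refutation ⇔ ¬SPC4. Sources: AkbulutMatveyev1998; Eliashberg1990; Eliashberg1992; Cerf1968. -/
@[route_item "route-SmoothPoincare4-SymplecticCap"]
def SympSteinSplitS3 : Prop :=
  ∀ S : Literature.Topology.FourManifolds.HomotopySphere 4, ∃ (W₁ : Type) (_ : TopologicalSpace W₁) (_ : ChartedSpace (EuclideanHalfSpace 4) W₁) (_ : IsManifold (𝓡∂ 4) ∞ W₁) (_ : CompactSpace W₁) (W₂ : Type) (_ : TopologicalSpace W₂) (_ : ChartedSpace (EuclideanHalfSpace 4) W₂) (_ : IsManifold (𝓡∂ 4) ∞ W₂) (_ : CompactSpace W₂) (e₁ : W₁ → S.carrier) (e₂ : W₂ → S.carrier), Literature.Geometry.Symplectic.IsSteinDomain W₁ ∧ Literature.Geometry.Symplectic.IsSteinDomain W₂ ∧ Manifold.IsSmoothEmbedding (𝓡∂ 4) (𝓡 4) ∞ e₁ ∧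 Manifold.IsSmoothEmbedding (𝓡∂ 4) (𝓡 4) ∞ e₂ ∧ Set.range e₁ ∪ Set.range e₂ = Set.univ ∧ Set.range e₁ ∩ Set.range e₂ = e₁ '' (𝓡∂ 4).boundary W₁ ∧ Set.range e₁ ∩ Set.range e₂ = e₂ '' (𝓡∂ 4).boundary W₂ ∧ Nonempty ((𝓡∂ 4).boundary W₁ ≃ₜ Metric.sphere (0 : EuclideanSpace ℝ (Fin 4)) 1)

/-- item stmt-SmoothPoincare4-0430 · support · rank 3 · open · by planner
why it might fail: needs a 3-handle-free decomposition of EVERY homotopy 4-ball (open; route NoOneHandles) and Legendrian realisability of the framings (the tb − 1 bound fails for many framed links); ⟺ SPC4 modulo Gompf1998 Thm 1.3 + Eliashberg1990 Thm 5.1 + Cerf.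
sources: Gompf1998, Eliashberg1990Stein, Eliashberg1990, AkbulutMatveyev1998, CieliebakEliashberg2012
INFORMAL (needs_definition: LegendrianKirbyDiagram — a handle decomposition of a compact 4-manifold
with one 0-handle, n 1-handles and 2-handles attached along a Legendrian link L in (#ⁿ S¹×S², ξ_std)
drawn in Gompf standard form, with framings tb(L_i) − 1; plus tb). Statement: every compact
contractible smooth 4-manifold Δ with ∂Δ ≅ S³ admits such a decomposition (no 3-, 4-handles). ⇒ Δ is
a Stein domain [Eliashberg1990Stein Thm 1.3.3; Gompf1998 Thm 1.3 (converse also: every Stein surface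
arises so)] ⇒ crux #2 (with W₂ = B⁴) and thesis #0. 'No 3-handles for Δ = Σ ∖ ball' ⇔ Σ has a handle
decomposition without 3-handles ⇔ (dually) without 1-handles: cf. route NoOneHandles item
stmt-SmoothPoincare4-0378; the new content is the framing inequality fr ≤ tb − 1 for some Legendrian
realisation after handle slides. Sources: Gompf1998 §1, Thm 1.3, §5; Eliashberg1990Stein;
GompfStipsicz1999 §11. -/
@[route_item "route-SmoothPoincare4-SymplecticCap"]
def SympLegendrianHandlebody : Prop :=
  ∀ (W : Type) [TopologicalSpace W] [T2Space W] [SecondCountableTopology W] [ChartedSpace (EuclideanHalfSpace 4) W] [IsManifold (𝓡∂ 4) ∞ W] [CompactSpace W] [ContractibleSpace W], Nonempty ((𝓡∂ 4).boundary W ≃ₜ Metric.sphere (0 : EuclideanSpace ℝ (Fin 4)) 1) → Literature.Geometry.Symplectic.IsSteinDomain W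

/-- item stmt-SmoothPoincare4-0443 · support · rank 4 · closed · proved by Summit.SmoothPoincare4.SmoothPoincare4.Theorems.sympcapGlueChartStandardEnd_proof (prover) · by planner
sources: Hirsch1976, Palais1960
For a homotopy 4-sphere Σ, p ∈ Σ and a diffeomorphism Φ : Σ∖{p} → ℝ⁴ which, on a punctured
chart-ball about p, equals ι ∘ (extChartAt p − extChartAt p p) with ι(z) = z/‖z‖² (inversion), Σ is
diffeomorphic to S⁴. Proof idea: define F : Σ → S⁴ by F = σ_N⁻¹ ∘ Φ on Σ∖p and F p = N (σ_N =
stereographic projection from the north pole, Mathlib `stereographic'`); near p, in the chart at p,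
F reads σ_N⁻¹ ∘ ι which is the smooth chart of S⁴ at N, so F and F⁻¹ are smooth. Refuter A-1 (note
on 0431): 'a version demanding the diffeo be standard near p WOULD be provable' — this is that
version, isolating the elementary part of the R7 assembly from the Gromov–McDuff input. Believed
PROVABLE in-tree (long but elementary: Diffeomorph from two smooth pieces agreeing on an open
overlap). Sources: Milnor1965 §1; LeeSmoothManifolds2013 Ch. 1 (sphere charts). opens: `open scoped
Manifold ContDiff`, `open ContinuousMap`; imports: Summits.SmoothPoincare4.Statement +
Literature.Topology.FourManifolds.HomotopySpheres + Literature.Geometry.Lorentzian.LeviCivita.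
Elaborated 2026-08-13 session 3 with plain `lean check` (folder/Sk/Sketch3.lean rc 0). -/
@[route_item "route-SmoothPoincare4-SymplecticCap"]
def SympcapGlueChartStandardEnd : Prop :=
  ∀ (S : Literature.Topology.FourManifolds.HomotopySphere 4) (p : S.carrier) (Φ : (⟨{p}ᶜ, isOpen_compl_singleton⟩ : TopologicalSpace.Opens S.carrier) ≃ₘ⟮𝓡 4, 𝓡 4⟯ EuclideanSpace ℝ (Fin 4)), (∃ ε : ℝ, 0 < ε ∧ ∀ x : (⟨{p}ᶜ, isOpen_compl_singleton⟩ : TopologicalSpace.Opens S.carrier), x.1 ∈ (chartAt (EuclideanSpace ℝ (Fin 4)) p).source → extChartAt (𝓡 4) p x.1 ∈ Metric.ball (extChartAt (𝓡 4) p p) ε → Φ x = (‖extChartAt (𝓡 4) p x.1 - extChartAt (𝓡 4) p p‖ ^ 2)⁻¹ • (extChartAt (𝓡 4) p x.1 - extChartAt (𝓡 4) p p)) → Nonempty (S.carrier ≃ₘ⟮𝓡 4, 𝓡 4⟯ Metric.sphere (0 : EuclideanSpace ℝ (Fin 5)) 1)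

-- `SympcapGlueChartStandardEnd` holds: proved by `Summit.SmoothPoincare4.SmoothPoincare4.Theorems.sympcapGlueChartStandardEnd_proof` (its module imports this route file, so no `_holds` link can be stated here).

/-- item stmt-SmoothPoincare4-0374 · support · rank 5 · closed · proved by Summit.SmoothPoincare4.SmoothPoincare4.Theorems.spc4ReductionHomotopySphere_proof (prover) · by planner
sources: HatcherAT2002, LeeSmoothManifolds2013, KervaireMilnor1963
Shared reduction (bookkeeping, known): SmoothPoincare4 quantifies over bare (M, T2, 2nd-countable,
charted, smooth, e : M ≃ₕ S⁴); a manifold ≃ₕ S⁴ is compact (H₄ ≠ 0 forces compactness) and simply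
connected hence smoothly orientable, so it packages as an
`Literature.Topology.FourManifolds.HomotopySphere 4`. Sources: KervaireMilnor1963 §1; Literature
HomotopySpheres.lean. opens: `open scoped Manifold ContDiff`, `open ContinuousMap`; imports:
Summits.SmoothPoincare4.Statement +
Literature.Topology.FourManifolds.{HomotopySpheres,KirbyMoves,SliceRibbon,LeeRasmussen,Morse,ConnectedSum,Cobordism,GluckTwist,SurgeryGluck,CappellShaneson}
+ Literature.Geometry.Lorentzian.LeviCivita. -/
@[route_item "route-SmoothPoincare4-SymplecticCap"]
def Spc4ReductionHomotopySphere : Prop :=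
  (∀ S : Literature.Topology.FourManifolds.HomotopySphere 4, Nonempty (S.carrier ≃ₘ⟮𝓡 4, 𝓡 4⟯ Metric.sphere (0 : EuclideanSpace ℝ (Fin 5)) 1)) → SmoothPoincare4

/-- `Spc4ReductionHomotopySphere` holds: proved by `Summit.SmoothPoincare4.SmoothPoincare4.Theorems.spc4ReductionHomotopySphere_proof`. -/
theorem Spc4ReductionHomotopySphere_holds : Spc4ReductionHomotopySphere := _root_.Summit.SmoothPoincare4.SmoothPoincare4.Theorems.spc4ReductionHomotopySphere_proof

/-- item stmt-SmoothPoincare4-0441 · support · rank 5 · open · by planner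
SUPERSEDES stmt-SmoothPoincare4-0374 (grounder B/A2 + refuter A-0/A-1: TRUE bookkeeping but not
staffable as a bare implication). Now carries the two packaging facts as hypotheses: (hC) a smooth
4-manifold M ≃ₕ S⁴ is compact [Hatcher2002 Prop 3.29 + Thm 2.13; cite item filed]; (hO) such an M is
orientable, `Literature.Topology.FourManifolds.IsOrientable (𝓡 4) M` [LeeSmoothManifolds2013 Thm
15.40 + Hatcher2002 Props 1.14/1.18; cite item filed]. Proof sketch (≈15 lines): intro hC hO h M _ _
_; unfold SmoothPoincare4 Literature.SPC4.SmoothPoincareConjectureFour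
HomotopyEquiv.NonemptyDiffeomorphSphere; intro _ _ e; haveI := hC M e; obtain ⟨o⟩ := hO M e; exact h
⟨M, o, ⟨e⟩⟩ (mind the anonymous-constructor field order of
Literature.Topology.FourManifolds.HomotopySphere: carrier, [6 instances], orientation,
nonempty_homotopyEquiv; universe: carrier : Type = SmoothPoincareConjectureFour.{0} ✓). opens: `open
scoped Manifold ContDiff`, `open ContinuousMap`; imports: Summits.SmoothPoincare4.Statement +
Literature.Topology.FourManifolds.HomotopySpheres + Literature.Geometry.Lorentzian.LeviCivita.
Elaborated 2026-08-13 session 3 with plain `lean check` (folder/Sk/Sketch3.lean rc 0). -/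
@[route_item "route-SmoothPoincare4-SymplecticCap"]
def Spc4ReductionHomotopySphereV2 : Prop :=
  (∀ (M : Type) [TopologicalSpace M] [T2Space M] [SecondCountableTopology M] [ChartedSpace (EuclideanSpace ℝ (Fin 4)) M] [IsManifold (𝓡 4) ∞ M], M ≃ₕ Metric.sphere (0 : EuclideanSpace ℝ (Fin 5)) 1 → CompactSpace M) → (∀ (M : Type) [TopologicalSpace M] [T2Space M] [SecondCountableTopology M] [ChartedSpace (EuclideanSpace ℝ (Fin 4)) M] [IsManifold (𝓡 4) ∞ M], M ≃ₕ Metric.sphere (0 : EuclideanSpace ℝ (Fin 5)) 1 → Literature.Topology.FourManifolds.IsOrientable (𝓡 4) M) → (∀ S : Literature.Topology.FourManifolds.HomotopySphere 4, Nonempty (S.carrier ≃ₘ⟮𝓡 4, 𝓡 4⟯ Metric.sphere (0 : EuclideanSpace ℝ (Fin 5)) 1)) → SmoothPoincare4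

/-- item stmt-SmoothPoincare4-11345 · support · rank 9 · open · by planner
sources: McDuffSalamon2017, Gromov1985
[support] Chain B of the route (the two chart-free cruxes are jointly sufficient, given the fact
item): GromovRecognitionRelEnd (stmt-SmoothPoincare4-11009, Gromov relative recognition, by name) →
SympEndStandard (8775) → SympPuncturedStandard (0431) → SmoothPoincare4. PROVABLE NOW — 12 tactic
lines compiled sorry-free (axioms propext/Classical.choice/Quot.sound) in the planner sketch
SketchB.lean, theorem sympcapEndStandardClosure_holds, attached as evidence: package M ≃ₕ S⁴ as a
HomotopySphere 4 (Literature.Topology.FourManifolds.compactSpace_of_homotopyEquiv_sphere_four_holds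
/ isOrientable_of_homotopyEquiv_sphere_four_holds), apply the fact to M :=
Literature.Geometry.Symplectic.punctured p with the end data of SympEndStandard (punctured homotopy
spheres are path connected with π₂ = 0:
Literature.Geometry.Symplectic.pathConnectedSpace_punctured_of_homotopySphere,
subsingleton_pi_two_punctured_of_homotopySphere), obtain Φ : Σ ∖ p ≃ₘ ℝ⁴, feed ⟨Φ⟩ to
SympPuncturedStandard (punctured p is ⟨{p}ᶜ, _⟩ definitionally), finish as in closes. Complements
the deciding theorem closes (chain A: GromovRecognitionRelEnd → SympcapThesisV2 → SmoothPoincare4).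
[deps: GromovRecognitionRelEnd, Symp -/
@[route_item "route-SmoothPoincare4-SymplecticCap"]
def SympcapEndStandardClosure : Prop :=
  GromovRecognitionRelEnd → SympEndStandard → SympPuncturedStandard → SmoothPoincare4

/-- item stmt-SmoothPoincare4-16773 · support · rank 9 · closed · proved by Summit.SmoothPoincare4.SmoothPoincare4.Theorems.GromovRecognitionRelEnd.CrossCapLaurent.GromovRecognitionRelEndOfJCurveFacts_of_line @ 23ef49a92432 (prover) · by planner
[support] GLUE — the picked line cross_cap_laurent ITSELF, with its three XL named-fact stubs
discharged by the promoted cruxes: AdjunctionEmbeddedSpheres → LocalFoliationEmbeddedSpheres →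
GromovCompactnessSpheres → GromovRecognitionRelEnd is the registered skeleton's kernel-checked
composition GromovRecognitionRelEnd_of (Cruxes/GromovRecognitionRelEnd/Lines/cross_cap_laurent.lean;
stubs stub_factAdjunction = F4, stub_factLocalFoliation = F1, stub_factCompactness = F2 are the
three cruxes by Iff.rfl) — what it still needs is exactly the lead lineage's in-flight work:
stub_coreGlue (pure topology over the facts, L–XL, lead c4) and the L-sized named facts F3
positivityOfIntersections_leafCoordinate (fact claim 780 live), F6
jSphere_wedgeCount_factorsThroughHomology, F6′ sphere_zeroSetIndex_factorsThroughHomology, on top of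
the FIVE LANDED outer stubs (stub_endDoesNotReturn p90141, stub_tameJ p91034, stub_capModel p97720,
stub_flatCutoff p90731, stub_tameMoser p90687) and the landed reductions (Reduction p100977,
ReductionCore p125494). Proof the day coreGlue + F3/F6/F6′ land: intro h4 h1 h2; exact <closing
composition> h1 h2 h4 … in a Theorems module importing the line's closing file -/
@[route_item "route-SmoothPoincare4-SymplecticCap"]
def GromovRecognitionRelEndOfJCurveFacts : Prop :=
  AdjunctionEmbeddedSpheres → LocalFoliationEmbeddedSpheres → GromovCompactnessSpheres → GromovRecognitionRelEnd

-- `GromovRecognitionRelEndOfJCurveFacts` holds: proved by `Summit.SmoothPoincare4.SmoothPoincare4.Theorems.GromovRecognitionRelEnd.CrossCapLaurent.GromovRecognitionRelEndOfJCurveFacts_of_line` @ 23ef49a92432 (its module imports this route file, so no `_holds` link can be stated here).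

/-- item stmt-SmoothPoincare4-9114 · support · rank 9 · open · by planner
sources: McDuffSalamon2017
[support] X → SympEndStandard — the chart end IS an end: with ψ = ι ∘ (e − e p) on a punctured
ε-chart-ball U whose closed image ball lies in the chart target, K = Uᶜ (compact in Σ ∖ p), R = ε⁻¹,
χ = e⁻¹(e p + ι ·), the nine clauses follow from IsSymplecticStandardNearPoint by the chain rule
(mfderiv of ι ∘ (e − e p) = Dι ∘ De) and compactness of Σ; this is exactly the bookkeeping inside
the proof of `gromov_recognitionR4_relEnd.chartForm` (GromovR4RelEnd.lean ll. 209–420), to be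
extracted as a lemma. Records formally that the target is a special case of crux 2. [difficulty:
provable-now] — sources: McDuffSalamon2017 -/
@[route_item "route-SmoothPoincare4-SymplecticCap"]
def ThesisGivesEndStandard : Prop :=
  SympcapThesisV2 → SympEndStandard

/-- item stmt-SmoothPoincare4-9123 · support · rank 9 · open · by planner
sources: McDuffSalamon2017, Gromov1985
[support] the route's proved spine — Gromov's relative recognition fact → X → SmoothPoincare4 (chart
form of the fact `gromovMcDuffChartForm_of_recognitionR4_relEnd` /
`nonempty_diffeomorph_sphere_of_recognitionR4_relEnd`, glue, reduction — all in tree); 6-line proof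
compiled sorry-free in folder/SketchProofs.lean (`smoothPoincare4_of_thesis`) and attached as
evidence. Once closed it records that the summit is closed modulo {X, gromov_recognitionR4_relEnd};
it subsumes the dropped Assembly3 (0519, `Literature.SPC4.sympcap_assembly`). [difficulty:
provable-now] — sources: McDuffSalamon2017, Gromov1985 -/
@[route_item "route-SmoothPoincare4-SymplecticCap"]
def DirectClosure : Prop :=
  GromovRecognitionRelEnd → SympcapThesisV2 → SmoothPoincare4

/-- item stmt-SmoothPoincare4-0428 · assembly · rank 1 · open · by planner
Δ := Σ ∖ e⁻¹(ball(e p, ε/2)) is a compact 4-manifold with ∂Δ ≅ S³ near which sf = e*ι*ω₀, i.e. (Δ,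
sf) is a strong symplectic filling of (S³, ξ_std) (radial Liouville field of ω₀ in inverted
coordinates points out of Δ). H₂(Δ) = 0 ⇒ minimal ⇒ Δ ≅ B⁴ [Gromov1985 0.3.C, McDuff1990 Thm 1.7,
Eliashberg1990 Thm 5.1 — to enter as a named fact hypothesis]. The cap is a chart ball, so Σ = B⁴
∪_φ B⁴ ≅ S⁴ [Cerf1968: π₀ Diff⁺(S³) = 1]; then stmt-SmoothPoincare4-0374. Sources: as cited;
KervaireMilnor1963 §1. opens: `open scoped Manifold ContDiff`, `open ContinuousMap`; imports:
Summits.SmoothPoincare4.Statement +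
Literature.Topology.FourManifolds.{HomotopySpheres,Morse,BalancedPresentation} +
Literature.Geometry.Kaehler.ManifoldForms. Elaborated 2026-08-13 with plain `lean check` (no
overlay). -/
@[route_item "route-SmoothPoincare4-SymplecticCap"]
def Assembly : Prop :=
  SympcapThesisV2 → GromovRecognitionRelEnd → SmoothPoincare4

-- records of items no longer active in this route (dropped / restated):
-- earlier Assembly2 (stmt-SmoothPoincare4-0444, dropped 2026-08-17T00:17:14Z): moot by None — (∀ (S : Literature.Topology.FourManifolds.HomotopySphere 4) (p : S.carrier) (ε : ℝ) (sf : Literature.Geometry.Kaehler.MForm (𝓡 4) (Literature.Geometry.Symplectic.punctured p) ℝ 2), Literature.Geometry.Symplectic.IsSymplecticStandardNearPoint p ε sf → ∃ Φ : (Literature.Geometry.Symplectic.punctured p) ≃ₘ⟮𝓡 4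
-- earlier Assembly3 (stmt-SmoothPoincare4-0519, dropped 2026-08-17T00:17:14Z): moot by None — (∀ (S : Literature.Topology.FourManifolds.HomotopySphere 4) (p : S.carrier) (ε : ℝ) (sf : Literature.Geometry.Kaehler.MForm (𝓡 4) (Literature.Geometry.Symplectic.punctured p) ℝ 2), Literature.Geometry.Symplectic.IsSymplecticStandardNearPoint p ε sf → ∃ Φ : (Literature.Geometry.Symplectic.punctured p) ≃ₘ⟮𝓡 4
-- earlier None (stmt-SmoothPoincare4-16761, dropped 2026-08-17T00:17:14Z): moot by None — ∀ (X : Type) [TopologicalSpace X] [T2Space X] [SecondCountableTopology X] [ChartedSpace (EuclideanSpace ℝ (Fin 4)) X] [IsManifold (𝓡 4) ∞ X] (JX : Literature.Geometry.Symplectic.AlmostComplexStructure (𝓡 4) ∞ X) (u₀ v₀ : ℂ → X) (N : Set X) (π : X → ℂ) (u v : ℂ → X) (F F₀ : C(Literature.Topology.FourManifolds.Co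

/-! D-0027 §2.1 — DECIDING THEOREM (planner-authored via `route open/edit --closes-file`; by planner-rchoice-SmoothPoincare4-SymplecticCap--3e07ae46-0 2026-08-15T17:25:19Z):
its hypotheses are this route's items and its conclusion the sub-problem Statement (glue_lint), and it elaborates with this file. -/

@[closes "route-SmoothPoincare4-SymplecticCap"] theorem closes (hG : GromovRecognitionRelEnd) (hX : SympcapThesisV2) : _root_.SmoothPoincare4 := by
  intro M _ _ _ _ _ e
  haveI : CompactSpace M :=
    Literature.Topology.FourManifolds.compactSpace_of_homotopyEquiv_sphere_four_holds M e
  obtain ⟨o⟩ :=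
    Literature.Topology.FourManifolds.isOrientable_of_homotopyEquiv_sphere_four_holds M e
  obtain ⟨ε, sf, h⟩ := hX ⟨M, o, ⟨e⟩⟩ (e.invFun ⟨EuclideanSpace.single 0 1, by simp⟩)
  exact Literature.Geometry.Symplectic.nonempty_diffeomorph_sphere_of_recognitionR4_relEnd
    hG _ _ ε sf h

end Summit.SmoothPoincare4.SmoothPoincare4.Theses.SymplecticCap
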